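import Summits.AnomalousDissipation.AnomalousDissipation.Theorems.EnsembleCeiling.Negative.SingleModeFat
import Summits.AnomalousDissipation.AnomalousDissipation.Theorems.EnsembleCeiling.Negative.OrthogonalClassFat
import Summits.AnomalousDissipation.AnomalousDissipation.Theorems.EnsembleCeiling.Negative.DiracAtoms
import Summits.AnomalousDissipation.AnomalousDissipation.Theorems.EnsembleCeiling.Negative.BeltramiFat
import Summits.AnomalousDissipation.AnomalousDissipation.Theorems.EnsembleCeiling.Negative.CellularFat
import Literature.Analysis.FluidPDE.StatisticalSolutionEnergyEq

/-!
# Disproof of `EnsembleCeiling` (stmt-AnomalousDissipation-14090) — findings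

Standing adversary file of the cdisprove seat `refuter-cdisprove-stmt-AnomalousDissipation-14090-0`
(crux rank 4 of route `TaylorCertificates`). Certified support:
`Theorems/EnsembleCeiling/Negative/SingleModeFat.lean` (p73909),
`Theorems/EnsembleCeiling/Negative/OrthogonalClassFat.lean` (p73915) and
`Theorems/EnsembleCeiling/Negative/DiracAtoms.lean` (p74354) and
`Theorems/EnsembleCeiling/Negative/BeltramiFat.lean` (p74739) and
`Theorems/EnsembleCeiling/Negative/CellularFat.lean` (p75017); everything below is proved from them
and from tree facts, prose only in docstrings.

THE CRUX. `EnsembleCeiling := ∃ f` smooth, div-free, mean-zero, `0 < ‖f‖₂²`, `∃ E ν₀ > 0`, `∀ ν ∈ (0,ν₀)`,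
`∀ μ`, `IsStationaryStatisticalSolution ν f μ → Integrable ‖·‖² μ → ensembleEnergy μ ≤ E`
(FMRT IV Def. 1.3: Borel probability measure on `H`, finite mean enstrophy (1.29), Liouville equation
(1.30) against all cylindrical tests, shell energy inequalities (1.31)).

VERDICT OF THIS FILE: NO KILL. The statement is existential in `f`; every mechanism known to produce
fat (energy `~ν⁻²`) stationary statistics needs the Stokes preimage `A⁻¹f` (or its gravest shell) to be
a steady Euler flow, and the prover chooses `f`. What is certified:

(a) LOAD-BEARING ANALYSIS
  * `ensembleCeiling_false_without_liouville`: drop (1.30) ⇒ FALSE for EVERY admissible `f`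
    (`δ_{Tf}`, `SingleModeFat.fat_without_liouville`). Any proof must use the Liouville equation.
  * `ensembleCeiling_iff_withoutIntegrable`: the hypothesis `Integrable ‖·‖² μ` is PROVABLY automatic
    (`IsStationaryStatisticalSolution.integrable_norm_sq`, Poincaré + (1.29)) — decoration.
  * `ensembleCeilingWithoutForceNonzero_holds`: drop `0 < ‖f‖₂²` ⇒ TRIVIALLY TRUE (`f = 0`: the support
    bound forces `μ = δ₀`-energy `0`). The exclusion of `f = 0` is exactly what keeps the crux honest.
  * `prob`, (1.29), (1.31) could not be dropped to a falsity cheaply: (1.31) alone already gives the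
    ν-DEPENDENT ceiling `‖f‖₂²/(16π⁴ν²)` (b); with (1.30) Dirac masses must sit at steady weak solutions
    (`ceilingAt_steady_bound` is the converse use).
(b) TIGHTNESS
  * `ensembleEnergy_le_support_bound`: every stationary statistical solution has
    `ensembleEnergy μ ≤ ‖f‖₂²/(16π⁴ν²)` (FMRT (1.34), tree `ae_norm_le`); `kolmogorov_attains_support_bound`
    (Part I): ATTAINED by the Kolmogorov laminar Dirac mass. So nothing that sees `f` only through
    `‖f‖₂` (or `‖f‖₂`, `ν`, `λ₁`) can give a ν-uniform `E`: the proof must use the GEOMETRY of `f`.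
(c) REFUTED STRENGTHENINGS / DEAD FORCE CLASSES (the conclusion `CeilingAt f` fails for):
  * every single transversal Fourier mode `Re(e_k z)` (`not_ceilingAt_singleMode`), in particular the
    strengthening "for EVERY admissible force" is false (`not_ensembleCeilingForall`);
  * the whole ORTHOGONAL CLASS `∑ₘ Re(e_{kₘ} zₘ)`, `kₘ'·zₘ = 0 ∀ m m'` — all unidirectional trig-poly forces
    `g(x·a,x·b)e`, `e ⊥ a,b`, and all one-coordinate shear forces, ANY number of shells
    (`not_ceilingAt_orthogonalClass`): "multi-mode with two shell radii" is NOT sufficient; the witness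
    needs a wavevector not orthogonal to some amplitude.
  * every SINGLE-SHELL WEAKLY EULER-STEADY trig force (`∫ (f⊗f):∇w = 0` for all tests; Part IV,
    `not_ceilingAt_singleShell_eulerSteady`) — laminar Dirac of energy `‖f‖₂²/(16π⁴s²ν²)`; discharged for
    the ABC (Arnold–Beltrami–Childress) pure-helical first-shell forces (`not_ceilingAt_abc`,
    `BeltramiFat.abc_inertial_eq_zero`): a Beltrami-wave witness must mix helicities or shells.
  * the planar single-shell CELLULAR forces `Re(e_{(1,1,0)}P(1,-1,0)) + Re(e_{(1,-1,0)}Q(1,1,0))`, in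
    particular the Taylor–Green / four-roll-mill force `(sin 2πx₁ cos 2πx₂, -cos 2πx₁ sin 2πx₂, 0)` (Part V,
    `not_ceilingAt_cellular`): the planar side of the Kishimoto–Yoneda dichotomy is dead too.
  * On paper: every `f` whose Stokes preimage `A⁻¹f` is a steady Euler flow (Taylor–Green 3-D is NOT such an `f`);
    perturbatively, Marchioro-stable neighbourhoods `‖f - f₀‖ ≲ ν` of gravest-shell forces (useless
    uniformly in `ν`). `x₃`-invariant forces with first-shell planar part: fat by
    `Literature.Barriers.AnomalousDissipation.Marchioro1986_globalAttraction` (laminar attraction).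
(d) TARGETS: none yet (no line picked; `payload.targets = []`).
(e') NUMERICS: kit j010239 — primary steady branches: GP saturates early, TG / two-shell bend late (§5 of `resists`).
(e) NEAR-MISSES / WHY IT RESISTS — see the docstring of `resists` at the end: for `f` with infinitely many
    active modes NO stationary statistical solution is supported on a finite-dimensional Fourier
    subspace (Liouville with localised `φ` forces `(1-P_W)B(u,u) = (1-P_W)f` a.e.), so every fat
    candidate is genuinely infinite-dimensional: large-energy steady states (exist for every `ν` by
    `Temam1979_exists_steadyWeakSolution_holds`, but with no lower energy bound) or non-trivial invariant
    statistics; their energy as `ν → 0` for a generic two-shell 3-D force is open both ways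
    (Re ≍ Gr^{1/2} saturation vs the laminar Re ≍ Gr, Doering–Foias 2002; FMRT IV §1).
-/

noncomputable section

open MeasureTheory UnitAddTorus Matrix
open scoped InnerProductSpace ENNReal ComplexConjugate

namespace Summit.AnomalousDissipation.AnomalousDissipation.Cruxes.EnsembleCeiling.Disproof

open Literature.Analysis.FunctionSpaces Literature.Analysis.FluidPDE
open Summit.AnomalousDissipation.AnomalousDissipation.Theses.TaylorCertificates
open Summit.AnomalousDissipation.AnomalousDissipation.Theorems.TaylorCertificatePair.Negative
open Summit.AnomalousDissipation.AnomalousDissipation.Theorems.EnsembleCeiling.Negative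

/-! ## 0. The crux, factored through the force -/

/-- Admissible forces of the crux: smooth, divergence free, mean zero, nonzero in `L²`. -/
def Admissible (f : (UnitAddTorus (Fin 3)) → (EuclideanSpace ℝ (Fin 3))) : Prop :=
  Torus.IsSmooth f ∧ Torus.IsDivFree f ∧ Torus.HasZeroMean f ∧ 0 < (∫ x, ‖f x‖ ^ 2)

/-- The conclusion of the crux for a given force: a ν-uniform ceiling on the mean energy of all
stationary statistical solutions of `NS_ν(f)` with integrable energy, `ν < ν₀`. -/
def CeilingAt (f : (UnitAddTorus (Fin 3)) → (EuclideanSpace ℝ (Fin 3))) : Prop :=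
  ∃ (E ν₀ : ℝ), 0 < ν₀ ∧ ∀ ν : ℝ, 0 < ν → ν < ν₀ → ∀ μ : Measure (Torus.energySpace (Fin 3)),
    Torus.IsStationaryStatisticalSolution ν f μ →
      Integrable (fun v : (Torus.energySpace (Fin 3)) => ‖v‖ ^ 2) μ → Torus.ensembleEnergy μ ≤ E

/-- `EnsembleCeiling ↔ ∃ f, Admissible f ∧ CeilingAt f` (definitional). -/
theorem ensembleCeiling_iff : EnsembleCeiling ↔ ∃ f, Admissible f ∧ CeilingAt f := by
  constructor
  · rintro ⟨f, hs, hd, hm, hp, h⟩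
    exact ⟨f, ⟨hs, hd, hm, hp⟩, h⟩
  · rintro ⟨f, ⟨hs, hd, hm, hp⟩, h⟩
    exact ⟨f, hs, hd, hm, hp, h⟩

/-- **The reduction every kill uses** (`DiracAtoms.norm_sq_le_of_ceiling`): a ceiling at `f`
bounds every finite-enstrophy steady weak solution `u ∈ V` of `NS_ν(f)`, `ν < ν₀`, by `‖u‖² ≤ E`.
Hence: to kill `CeilingAt f` it suffices to exhibit steady states of `NS_ν(f)` of unbounded energy as
`ν → 0` — and by `DiracAtoms.dirac_isStationary_iff_isSteadyWeakSolution` Dirac masses offer NOTHING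
ELSE: the atoms of the Foias–Prodi class are exactly the steady states. -/
theorem ceilingAt_steady_bound {f : (UnitAddTorus (Fin 3)) → (EuclideanSpace ℝ (Fin 3))}
    (hf : MemLp f 2 volume) (h : CeilingAt f) :
    ∃ (E ν₀ : ℝ), 0 < ν₀ ∧ ∀ ν : ℝ, 0 < ν → ν < ν₀ → ∀ u : (Torus.energySpace (Fin 3)),
      ((u : (Torus.energySpace (Fin 3))) : (Lp (EuclideanSpace ℝ (Fin 3)) 2 (volume : Measure (UnitAddTorus (Fin 3))))) ∈ Torus.energySpaceV (Fin 3) →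
        Torus.IsSteadyWeakSolution ν f u → ‖u‖ ^ 2 ≤ E := by
  obtain ⟨E, ν₀, hν₀, h⟩ := h
  exact ⟨E, ν₀, hν₀, fun ν hν hνlt u hV hu => norm_sq_le_of_ceiling hν hf (h ν hν hνlt) hV hu⟩

/-! ## (a) Load-bearing analysis -/

/-- VARIANT: the crux with the Liouville equation (1.30) DROPPED from the notion of stationary
statistical solution (keeping: probability measure, finite mean enstrophy (1.29), shell energy
inequalities (1.31), integrable energy). -/
def EnsembleCeilingWithoutLiouville : Prop :=
  ∃ f : (UnitAddTorus (Fin 3)) → (EuclideanSpace ℝ (Fin 3)), Admissible f ∧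
    ∃ (E ν₀ : ℝ), 0 < ν₀ ∧ ∀ ν : ℝ, 0 < ν → ν < ν₀ → ∀ μ : Measure (Torus.energySpace (Fin 3)),
      IsProbabilityMeasure μ →
      ∫⁻ u, Torus.eGradNormSq (((u : (Torus.energySpace (Fin 3))) : (Lp (EuclideanSpace ℝ (Fin 3)) 2 (volume : Measure (UnitAddTorus (Fin 3))))) : ((UnitAddTorus (Fin 3)) → (EuclideanSpace ℝ (Fin 3)))) ∂μ < ∞ →
      (∀ e₁ e₂ : ℝ≥0∞, e₁ < e₂ →
        ∫ u in {u : (Torus.energySpace (Fin 3)) | e₁ ≤ ‖u‖ₑ ^ 2 ∧ ‖u‖ₑ ^ 2 < e₂},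
          (ν * (Torus.eGradNormSq (((u : (Torus.energySpace (Fin 3))) : (Lp (EuclideanSpace ℝ (Fin 3)) 2 (volume : Measure (UnitAddTorus (Fin 3))))) : ((UnitAddTorus (Fin 3)) → (EuclideanSpace ℝ (Fin 3))))).toReal -
            Torus.pairing ((u : (Torus.energySpace (Fin 3))) : (Lp (EuclideanSpace ℝ (Fin 3)) 2 (volume : Measure (UnitAddTorus (Fin 3))))) f) ∂μ ≤ 0) →
      Integrable (fun v : (Torus.energySpace (Fin 3)) => ‖v‖ ^ 2) μ → Torus.ensembleEnergy μ ≤ E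

/-- **Any proof must use the Liouville equation**: without (1.30) the ceiling fails for EVERY
admissible force (the ray states `δ_{Tf}`; `fat_without_liouville`). -/
theorem ensembleCeiling_false_without_liouville : ¬ EnsembleCeilingWithoutLiouville := by
  rintro ⟨f, ⟨hs, hd, hm, hp⟩, E, ν₀, hν₀, h⟩
  obtain ⟨ν, hν, hνlt, μ, hprob, hens, hshell, hint, hE⟩ := fat_without_liouville hs hd hm hp E hν₀
  exact absurd (h ν hν hνlt μ hprob hens hshell hint) (not_le.2 hE)

/-- VARIANT: the crux without the integrability hypothesis. -/
def EnsembleCeilingWithoutIntegrable : Prop :=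
  ∃ f : (UnitAddTorus (Fin 3)) → (EuclideanSpace ℝ (Fin 3)), Admissible f ∧
    ∃ (E ν₀ : ℝ), 0 < ν₀ ∧ ∀ ν : ℝ, 0 < ν → ν < ν₀ → ∀ μ : Measure (Torus.energySpace (Fin 3)),
      Torus.IsStationaryStatisticalSolution ν f μ → Torus.ensembleEnergy μ ≤ E

/-- **The integrability hypothesis is decoration**: every stationary statistical solution has
integrable energy (`IsStationaryStatisticalSolution.integrable_norm_sq`: Poincaré and (1.29)), so
the two forms are equivalent (with the same `E`). Provers may ignore the hypothesis. -/
theorem ensembleCeiling_iff_withoutIntegrable : EnsembleCeiling ↔ EnsembleCeilingWithoutIntegrable := by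
  rw [ensembleCeiling_iff]
  constructor
  · rintro ⟨f, hf, E, ν₀, hν₀, h⟩
    exact ⟨f, hf, E, ν₀, hν₀, fun ν hν hνlt μ hμ => h ν hν hνlt μ hμ hμ.integrable_norm_sq⟩
  · rintro ⟨f, hf, E, ν₀, hν₀, h⟩
    exact ⟨f, hf, E, ν₀, hν₀, fun ν hν hνlt μ hμ _ => h ν hν hνlt μ hμ⟩

/-- VARIANT: the crux WITHOUT the exclusion `0 < ‖f‖₂²`. -/
def EnsembleCeilingWithoutForceNonzero : Prop :=
  ∃ f : (UnitAddTorus (Fin 3)) → (EuclideanSpace ℝ (Fin 3)),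
    Torus.IsSmooth f ∧ Torus.IsDivFree f ∧ Torus.HasZeroMean f ∧ CeilingAt f

/-! ## (b) Tightness: the ν-dependent ceiling every stationary statistical solution obeys -/

/-- **FMRT's support bound as a ceiling** (Ch. IV (1.34)): for `ν > 0` and `f ∈ L²` every stationary
statistical solution has `ensembleEnergy μ ≤ ‖f‖₂² / (16π⁴ν²)` (`λ₁ = 4π²`). This is the ONLY
ceiling obtainable from (1.31) alone, and it is ν-dependent. -/
theorem ensembleEnergy_le_support_bound {ν : ℝ} (hν : 0 < ν)
    {f : (UnitAddTorus (Fin 3)) → (EuclideanSpace ℝ (Fin 3))} (hf : MemLp f 2 volume)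
    {μ : Measure (Torus.energySpace (Fin 3))} (hμ : Torus.IsStationaryStatisticalSolution ν f μ) :
    Torus.ensembleEnergy μ ≤ ‖hf.toLp f‖ ^ 2 / (16 * Real.pi ^ 4 * ν ^ 2) := by
  haveI := hμ.prob
  have hR : ‖hf.toLp f‖ ^ 2 / (16 * Real.pi ^ 4 * ν ^ 2) = (‖hf.toLp f‖ / (4 * Real.pi ^ 2 * ν)) ^ 2 := by
    field_simp
    ring
  unfold Torus.ensembleEnergy
  rw [hR]
  calc ∫ u, ‖u‖ ^ 2 ∂μ ≤ ∫ _u, (‖hf.toLp f‖ / (4 * Real.pi ^ 2 * ν)) ^ 2 ∂μ := by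
        refine integral_mono_ae hμ.integrable_norm_sq (integrable_const _) ?_
        filter_upwards [hμ.ae_norm_le hν hf] with u hu
        exact pow_le_pow_left₀ (norm_nonneg _) hu 2
    _ = (‖hf.toLp f‖ / (4 * Real.pi ^ 2 * ν)) ^ 2 := by simp

/-- With `f = 0` every stationary statistical solution has mean energy `0` (support bound), so the
variant WITHOUT `0 < ‖f‖₂²` holds trivially: the exclusion of `f = 0` is load-bearing for honesty,
not for truth. -/
theorem ensembleCeilingWithoutForceNonzero_holds : EnsembleCeilingWithoutForceNonzero := by
  refine ⟨fun _ => 0, Torus.isSmooth_const _, ?_, ?_, 0, 1, one_pos, fun ν hν _ μ hμ _ => ?_⟩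
  · intro x
    simp [Torus.divergence, Torus.partialDeriv, Torus.lineDeriv]
  · simp [Torus.HasZeroMean]
  · have hf : MemLp (fun _ : (UnitAddTorus (Fin 3)) => (0 : EuclideanSpace ℝ (Fin 3))) 2 volume := memLp_const _
    have h := ensembleEnergy_le_support_bound hν hf hμ
    have h0 : ‖hf.toLp _‖ = 0 := by
      rw [norm_eq_zero]
      exact Lp.eq_zero_iff_ae_eq_zero.2 (hf.coeFn_toLp.trans (ae_of_all _ fun _ => rfl))
    rw [h0] at h
    simpa using h

/-! ## (c) Refuted strengthenings: dead force classes -/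

/-- The strengthening of the crux from SOME admissible force to EVERY admissible force. -/
def EnsembleCeilingForall : Prop :=
  ∀ f : (UnitAddTorus (Fin 3)) → (EuclideanSpace ℝ (Fin 3)), Admissible f → CeilingAt f

/-- **FALSE strengthening**: not every admissible force has a ceiling (Kolmogorov witness
`cos(2πx₂)e₀`; `SingleModeFat.not_forall_forces_ensembleCeiling`). -/
theorem not_ensembleCeilingForall : ¬ EnsembleCeilingForall := fun h =>
  not_forall_forces_ensembleCeiling fun f hs hd hm hp => h f ⟨hs, hd, hm, hp⟩

/-- **Dead class 1: single transversal modes.** `CeilingAt (Re(e_k z))` fails for `k ≠ 0`, `k·z = 0`,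
`z ≠ 0` (laminar Dirac masses of energy `½(4π²|k|²ν)⁻²‖z‖²`). -/
theorem not_ceilingAt_singleMode {k : Fin 3 → ℤ} {z : EuclideanSpace ℂ (Fin 3)} (hk : k ≠ 0)
    (hz : ((fun j => ((k) j : ℂ)) ⬝ᵥ (WithLp.ofLp (z))) = 0) (hz0 : z ≠ 0) :
    ¬ CeilingAt (Torus.realTrigPoly {k} (fun _ => z)) :=
  not_ceiling_of_singleMode hk hz hz0

/-- **Dead class 2: the orthogonal class** (all wavevectors orthogonal to all amplitudes; frequencies
nonzero, pairwise distinct and non-opposite; some amplitude nonzero): unidirectional trig-poly forces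
and one-coordinate shear forces with ANY number of shells have no ceiling
(`OrthogonalClassFat.not_ceiling_of_orthogonalClass`). A witness of the crux needs SOME wavevector
`kₘ'` with `kₘ' · zₘ ≠ 0` for SOME amplitude `zₘ`. -/
theorem not_ceilingAt_orthogonalClass {n : ℕ} {k : Fin n → (Fin 3 → ℤ)} {z : Fin n → (EuclideanSpace ℂ (Fin 3))}
    (hk : ∀ m, k m ≠ 0) (horth : ∀ m m', ((fun j => (((k m')) j : ℂ)) ⬝ᵥ (WithLp.ofLp ((z m)))) = 0)
    (hres : ∀ m m', m ≠ m' → k m ≠ k m' ∧ k m ≠ -k m') (hz : ∃ m, z m ≠ 0) :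
    ¬ CeilingAt (∑ mm, Torus.realTrigPoly {k mm} (fun _ => z mm)) :=
  not_ceiling_of_orthogonalClass hk horth hres hz

/-- **Dead class 3: single-shell weakly Euler-steady forces** (`BeltramiFat`): one Stokes shell
`|kₘ|² = s`, transversal amplitudes, `∫ (f ⊗ f) : ∇w = 0` for all test fields, `f ≠ 0` — no ceiling
(laminar branch `f/(4π²sν)`). With Kishimoto–Yoneda's rigidity this is the last exact-branch class. -/
theorem not_ceilingAt_singleShell_eulerSteady {n : ℕ} {k : Fin n → (Fin 3 → ℤ)} {z : Fin n → (EuclideanSpace ℂ (Fin 3))}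
    {s : ℝ} (hs : ∀ m, Torus.freqNormSq (k m) = s) (hs0 : 0 < s)
    (hz : ∀ m, ((fun j => (((k m)) j : ℂ)) ⬝ᵥ (WithLp.ofLp ((z m)))) = 0)
    (hI : ∀ w : (UnitAddTorus (Fin 3)) → (EuclideanSpace ℝ (Fin 3)), Torus.IsSmooth w → Torus.IsDivFree w →
      Torus.HasZeroMean w →
        ∫ x, ⟪Torus.fderiv w x ((∑ mm, Torus.realTrigPoly {k mm} (fun _ => z mm)) x),
          (∑ mm, Torus.realTrigPoly {k mm} (fun _ => z mm)) x⟫_ℝ = 0)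
    (hf0 : 0 < ∫ x, ‖(∑ mm, Torus.realTrigPoly {k mm} (fun _ => z mm)) x‖ ^ 2) :
    ¬ CeilingAt (∑ mm, Torus.realTrigPoly {k mm} (fun _ => z mm)) :=
  not_ceiling_of_singleShell_eulerSteady hs hs0 hz hI hf0

/-- **Dead instance: the ABC forces** `(A sin 2πx₃ + C cos 2πx₂, B sin 2πx₁ + A cos 2πx₃,
C sin 2πx₂ + B cos 2πx₁)`, `(A,B,C) ≠ 0` (`BeltramiFat.not_ceiling_abc`). -/
theorem not_ceilingAt_abc {A B C : ℝ} (h : A ≠ 0 ∨ B ≠ 0 ∨ C ≠ 0) :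
    ¬ CeilingAt (∑ mm, Torus.realTrigPoly {(![![0, 0, 1], ![1, 0, 0], ![0, 1, 0]] : Fin 3 → (Fin 3 → ℤ)) mm}
        (fun _ => (![(A : ℂ) • (WithLp.toLp 2 ![-Complex.I, 1, 0] : EuclideanSpace ℂ (Fin 3)),
                    (B : ℂ) • (WithLp.toLp 2 ![0, -Complex.I, 1] : EuclideanSpace ℂ (Fin 3)),
                    (C : ℂ) • (WithLp.toLp 2 ![1, 0, -Complex.I] : EuclideanSpace ℂ (Fin 3))] : Fin 3 → EuclideanSpace ℂ (Fin 3)) mm)) :=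
  not_ceiling_abc h

/-- **Dead instance: planar cellular forces** (`CellularFat.not_ceiling_cellular`), `(P,Q) ≠ 0`; Taylor–Green /
four-roll-mill cellular forcing is `P = Q = -i/2`. -/
theorem not_ceilingAt_cellular {P Q : ℂ} (h : P ≠ 0 ∨ Q ≠ 0) :
    ¬ CeilingAt (∑ mm, Torus.realTrigPoly {(![![1, 1, 0], ![1, -1, 0]] : Fin 2 → (Fin 3 → ℤ)) mm}
        (fun _ => (![P • (WithLp.toLp 2 ![1, -1, 0] : EuclideanSpace ℂ (Fin 3)),
                    Q • (WithLp.toLp 2 ![1, 1, 0] : EuclideanSpace ℂ (Fin 3))] : Fin 2 → EuclideanSpace ℂ (Fin 3)) mm)) :=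
  not_ceiling_cellular h

/-- **Tightness witness** (re-export of Part I): for the Kolmogorov force and EVERY `ν > 0` the support
bound of `ensembleEnergy_le_support_bound` is attained — `E(ν) = ‖f‖₂²/(16π⁴ν²)` exactly. -/
theorem support_bound_attained (z : (EuclideanSpace ℂ (Fin 3)))
    (hz : ((fun j => (((![0, 1, 0] : Fin 3 → ℤ)) j : ℂ)) ⬝ᵥ (WithLp.ofLp (z))) = 0) {ν : ℝ} (hν : 0 < ν) :
    ∃ μ : Measure (Torus.energySpace (Fin 3)),
      Torus.IsStationaryStatisticalSolution ν (Torus.realTrigPoly {(![0, 1, 0] : Fin 3 → ℤ)} (fun _ => z)) μ ∧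
        Integrable (fun v : (Torus.energySpace (Fin 3)) => ‖v‖ ^ 2) μ ∧
          Torus.ensembleEnergy μ =
            (∫ x, ‖(Torus.realTrigPoly {(![0, 1, 0] : Fin 3 → ℤ)} (fun _ => z)) x‖ ^ 2) / (16 * Real.pi ^ 4 * ν ^ 2) :=
  kolmogorov_attains_support_bound z hz hν

/-! ## (d) Targets

None yet: no line has been picked for this crux (`payload.targets = []`). When the lead's skeleton
is registered its stubs are attacked here (`theorem <stub>_false : ¬ …`). -/

/-! ## (e) Why the crux resists a cheap kill -/

/-- **WHY `EnsembleCeiling` RESISTS** (recorded as a trivial theorem so that the text travels with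
the tree; the statement is `True`).

1. FAITHFUL FORMALISATION — no junk measure helps the adversary. `prob` excludes scaling `c • μ`;
   the Liouville clause quantifies over ALL cylindrical tests with compactly supported `C¹` profiles,
   so localising `φ` around the coordinates of an atom shows that every ATOM of a stationary
   statistical solution is a steady weak solution (and conversely, `ceilingAt_steady_bound`); the
   shell inequalities (1.31) are genuine on bounded shells (integrands are integrable there), and the
   unbounded shell is exactly FMRT's support bound (`ensembleEnergy_le_support_bound`); the Bochner
   junk of `ensembleEnergy` (non-integrable ⇒ `0`) only favours the prover and is anyway vacuous
   (`integrable_norm_sq`). Measurability is no loophole either: `u ↦ ⟨F(u), Φ'(u)⟩` is continuous on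
   `H` (`continuous_nsGeneratorPairing_grad`).
2. NO FINITE-DIMENSIONAL FAT STATISTICS FOR GENERIC `f`. If `μ` is carried by a finite-dimensional
   Fourier subspace `W = P_Λ H`, testing (1.30) with `g`'s in `W ⊕ W'` (`W'` = the modes of
   `supp f̂ ∪ (Λ+Λ)` outside `Λ`) and profiles `φ(y) = a(y_W) + y_{W'} b(y_W)` gives
   `(1 - P_W)(B(u,u) - f) = 0` for `μ`-a.e. `u` — impossible as soon as `f̂` has a mode outside
   `Λ ∪ (Λ+Λ)`, e.g. for every `f` with infinitely many active modes. So every fat candidate for a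
   generic force is genuinely infinite-dimensional: a large-energy steady state (they EXIST for every
   `ν`, `Temam1979_exists_steadyWeakSolution_holds`, but the only bounds are
   `(f,u) = ν‖∇u‖²`, `‖u‖ ≤ ‖f‖/(νλ₁)` from above and nothing from below), a periodic orbit, or
   genuinely turbulent invariant statistics.
3. THE MECHANISM GAP. All certified kills (Parts I–II) and all printed ones (Marchioro 1986 / FMRT
   III §3.1: first-shell forcing, laminar attraction; single-eigenspace forcing, Constantin–Foias–
   Manley 1994, Tran–Shepherd 2002; Beltrami/ABC and every `f` with Euler-steady `A⁻¹f`) use an EXACT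
   laminar branch `u_ν = (νA)⁻¹f`, i.e. `P B(A⁻¹f, A⁻¹f) = 0`. For trigonometric-polynomial forces
   this mechanism is COMPLETELY CLASSIFIED by the tree fact
   `Literature.Analysis.FluidPDE.KishimotoYoneda2022_finiteMode_rigidity` (J. Math. Fluid Mech. 24
   (2022), Thm. 1.4): a finite-mode steady Euler flow has Fourier support in a PLANE through the
   origin (2D-like: the orthogonal class of Part II, 2-D single-shell cellular forces, …) or on ONE
   SPHERE with `A⁻¹f` Beltrami (ABC-type, pure helicity). So the exact-branch adversary is exhausted by
   {planar-supported Euler-steady preimages} ∪ {single-shell Beltrami}; every genuinely 3-D force with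
   two shell radii, or one shell of mixed helicity (the ideators' frustrated `f_GP = h₊ + T_a h₋`), is
   OUTSIDE it. For a force with `P B(A⁻¹f,A⁻¹f) ≠ 0`
   (the route's "non-Euler-steady gravest shell", e.g. two non-parallel shear modes in different
   shells, or Taylor–Green-type forces) the Stokes state is NOT steady, the steady branch through it
   bends at `‖u‖ ~ 1` Reynolds numbers, and whether ANY steady state / invariant measure keeps
   energy `≫ 1` as `ν → 0` is open — this is the laminar-vs-turbulent saturation question
   `Re ≍ Gr` vs `Re ≍ Gr^{1/2}` (Doering–Foias 2002; FMRT IV §1), open in both directions. A perturbative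
   branch `u = (c/ν)v₀ + w` around a shear/Beltrami profile `v₀` requires solving
   `L_{v₀}w ≈ (ν/c)f - cλv₀` with the non-invertible linearised Euler operator `L_{v₀}` (critical layers,
   infinite-dimensional kernel): no construction is known for generic `f`.
4. WHAT A PROVER MUST THEREFORE DO: choose `f` outside every exact-laminar class (Parts I–V give the
   Lean-checkable list), and bound the energy of ALL stationary statistics ν-uniformly using (1.30) —
   by (a) nothing less will do, by (b) nothing insensitive to the geometry of `f` will do.
5. NUMERICS (kit job j010239, `compute/steady_branch.py`, evidence on the item; N = 24 pseudo-spectral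
   Newton–GMRES continuation of the PRIMARY STEADY BRANCH from the Stokes state, `ν = 1 → 0.0115`,
   2/3-dealiased, under-resolved below `ν ≈ 0.02`; ratio `r(ν) := E(ν)·16π⁴ν²/‖f‖₂²`, laminar first-shell
   value `1`): KOL `e₁ sin 2πx₂` (control): `r ≡ 1.0000` to machine precision — the exact branch of Part I.
   GP `(sin 2πx₃, sin 2πx₁, sin 2πx₂)` (first shell, mixed helicity, NOT Euler-steady): the branch BENDS
   EARLY — `r = 0.96 (ν=.107), 0.70 (.055), 0.43 (.035), 0.23 (.0225), 0.12 (.0144), 0.08 (.0115)`;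
   injection `(f,u) = ν‖∇u‖²` FLATTENS at `≈ 0.56–0.61` for `ν ≲ 0.03` and `E ≈ 0.39 → 0.60` over
   `ν = .028 → .0115` (`E ~ ν^{-0.4}`, not `ν^{-2}`): the primary steady branch of the ideators' force
   saturates — weak evidence FOR `CeilingAt f_GP` on that branch (it says nothing about other
   stationary statistics). TG `(sin cos cos, -cos sin cos, 0)·(2π·)` (shell 3, not Euler-steady): `r`
   stays at its laminar value `1/9 = 0.111` down to `ν ≈ 0.03` and is still `0.086` at `ν = 0.0115`
   (`E = 0.104` vs laminar `0.134`): LATE bending — the solenoidal part of `(u_S·∇)u_S` is small for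
   Taylor–Green, so its steady branch is fat down to `Re ~ 30`. TWO `e₃ sin 2πx₁ + e₁ sin 2π(x₂+x₃)`
   (shells 1+2, non-orthogonal): `r = 0.625 → 0.49` at `ν = 0.0144` (`E = 1.51`, laminar `1.93`): also
   late bending. LESSON for witnesses: "non-Euler-steady Stokes preimage" is necessary but the SIZE of
   the solenoidal defect `P B(A⁻¹f, A⁻¹f)` decides where the laminar branch lets go; forces with a small
   defect (TG-like, weakly interacting two-shell pairs) carry near-laminar fat steady states far down in
   `ν`, and nothing here shows their branches ever saturate. -/
theorem resists : True := trivial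

end Summit.AnomalousDissipation.AnomalousDissipation.Cruxes.EnsembleCeiling.Disproof
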